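import Literature.NumberTheory.Transcendental.PadicLogAlgClProofs
import Mathlib.Topology.Algebra.OpenSubgroup
import HarnessLib

/-!
# X11b @ `p = 3`, S24-a (λ-supply), part (D-I): principal units of an ultrametric `ℚ_p`-algebra —
# torsion, and compact images of characters

HONEST FRAMING (cell `b2b-bsdres`, run/shared/lean/b2b/bsd-rank1-residual/, verbatim in every
file): the goal of the cell is to DELETE the COMBINATION-SHAPED residual classes of the
Birch–Swinnerton-Dyer formula for ALL analytic-rank `≤ 1` elliptic curves over `ℚ` — assembled
STRICTLY from published theorems — so that the rank-`≤ 1` remainder becomes exactly the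
CONSTRUCTION-SHAPED classes, which are TYPED, NOT attempted. This is not "finishing BSD". Team N8/O2
(X11b at `3`: `3 ‖ N`, `r_an = 1`, `E[3]` irreducible): research route; nothing booked; NO label
changes; O2 stays OPEN. THEOREMS ONLY (elementary `p`-adic analysis); no definition, no fact, no
`sorry`.

PROVENANCE: sub-target S24 'λ-SUPPLY SPLIT' (OWNERS R7-59, lead x11b3 GEN 6/7), seat
`b2b-bsdres-x11b3-p7` (gen. 4); feasibility census `HOME/b2b-bsdres-x11b3-p7/s24/S24-FEASIBILITY.md`
step (D) "3-adic toolkit". Setting: a normed field `F` which is a normed `ℚ_p`-algebra with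
ultrametric distance (the tree's `IwasawaLog` setting, `Transcendental/PadicLogAlgClProofs.lean` §A),
complete where limits are taken — in the application `F` is the complete finite subextension
`ℚ_p(values of Ψ) ⊂ ℚ̄_p` of Weil's construction (`lAdicValueField`). The subgroup of PRINCIPAL
UNITS `P = {u : ‖1 - u‖ < 1}` of `Fˣ` is handled receptacle-style (any `P : Subgroup Fˣ` with the
membership characterisation `hP`), so that no definition is introduced.

## What this file proves

* §1 `exists_principalUnits`, `exists_ballUnits`: `{‖1-u‖ < 1}` and `{‖1-u‖ ≤ ρ}` (`0 ≤ ρ < 1`) are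
  subgroups of `Fˣ`, open (`isOpen_setOf_norm_one_sub_lt/le`).
* §2 torsion: a principal unit `u` with `u^m = 1`, `p ∤ m`, is `1` (`eq_one_of_pow_eq_one_of_coprime`;
  `‖1 + u + ⋯ + u^{m-1}‖ = ‖m‖ = 1`); in particular `P` has no element of order `2` for `p` odd.
  For `p = 3`: a unit `x` with `x³` principal is principal (`norm_one_sub_lt_of_pow_three`:
  `x²+x+1 = (x-1)² + 3x`).
* §3 compact images: a continuous homomorphism `g : G → Fˣ` from a compact group is unit-valued
  (`norm_apply_eq_one`) and some power `g^n`, `n ≥ 1`, is valued in any given open subgroup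
  (`exists_pow_mem_of_isOpen`: open subgroups of compact groups have finite index); for `p = 3`,
  `n` prime to `3` for `P` itself (`exists_pow_mem_principalUnits_coprime_three`).
* The sibling `LambdaSupplyTeichmueller.lean` continues with §4 (Teichmüller splitting of a
  character, `exists_teichmueller_splitting`) and §5 (`ℤ_p`-powers of a principal unit, `exists_zpPow`).

## References

* [Serre1973] J.-P. Serre, *A Course in Arithmetic*, Ch. II §3 (structure of the
  units of a `p`-adic field; principal units).
* [Washington1997] L. C. Washington, *Introduction to Cyclotomic Fields*, §5.1 (the functions
  `(1+q)^x`; Teichmüller character).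
-/

noncomputable section

open Filter Topology

namespace Summit.BirchSwinnertonDyer.Rank1Residual.X11b.Three.LambdaSupply.PadicUnits

open Literature.NumberTheory.Transcendental Literature.NumberTheory.Transcendental.IwasawaLog

variable {p : ℕ} [Fact p.Prime] {F : Type*} [NormedField F] [instF : NormedAlgebra ℚ_[p] F]
  [IsUltrametricDist F]

/-! ### §1. Principal units and congruence balls are open subgroups -/

omit instF in
/-- In an ultrametric normed field, `‖a - b‖ < ‖b‖` forces `‖a‖ = ‖b‖`. [folklore] -/
theorem norm_eq_of_norm_sub_lt {a b : F} (h : ‖a - b‖ < ‖b‖) : ‖a‖ = ‖b‖ := by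
  refine le_antisymm ?_ ?_
  · have h1 := IsUltrametricDist.norm_add_le_max (a - b) b
    rw [sub_add_cancel] at h1
    exact h1.trans (max_le h.le le_rfl)
  · by_contra hlt
    push Not at hlt
    have h1 := IsUltrametricDist.norm_add_le_max a (-(a - b))
    rw [show a + -(a - b) = b by ring, norm_neg] at h1
    exact absurd h1 (not_le.mpr (max_lt hlt h))

omit instF in
/-- **The principal units form a subgroup of `Fˣ`** (`‖1 - uv‖ ≤ max (‖1-u‖, ‖u‖‖1-v‖)`,
`‖1 - u⁻¹‖ = ‖1 - u‖`; receptacle form: SOME subgroup has exactly this membership).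
Serre, *A Course in Arithmetic*, II §3.1. [cite: Serre1973, Ch. II §3.1] -/
theorem exists_principalUnits : ∃ P : Subgroup Fˣ, ∀ u : Fˣ, u ∈ P ↔ ‖1 - (u : F)‖ < 1 :=
  ⟨{ carrier := {u | ‖1 - (u : F)‖ < 1}
     one_mem' := by simp
     mul_mem' := fun {a b} ha hb => by
       simp only [Set.mem_setOf_eq, Units.val_mul] at ha hb ⊢
       exact norm_one_sub_mul_lt ha hb
     inv_mem' := fun {a} ha => by
       simp only [Set.mem_setOf_eq, Units.val_inv_eq_inv_val] at ha ⊢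
       exact norm_one_sub_inv_lt ha }, fun _ => Iff.rfl⟩

omit instF in
/-- **Congruence balls are subgroups**: for `0 ≤ ρ < 1`, `{u : ‖1 - u‖ ≤ ρ}` is a subgroup of `Fˣ`
(receptacle form). [cite: Serre1973, Ch. II §3.1] -/
theorem exists_ballUnits {ρ : ℝ} (h0 : 0 ≤ ρ) (h1 : ρ < 1) :
    ∃ B : Subgroup Fˣ, ∀ u : Fˣ, u ∈ B ↔ ‖1 - (u : F)‖ ≤ ρ :=
  ⟨{ carrier := {u | ‖1 - (u : F)‖ ≤ ρ}
     one_mem' := by simpa using h0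
     mul_mem' := fun {a b} ha hb => by
       simp only [Set.mem_setOf_eq, Units.val_mul] at ha hb ⊢
       have hna : ‖(a : F)‖ = 1 := norm_eq_one_of_norm_one_sub_lt (ha.trans_lt h1)
       have : (1 : F) - a * b = (1 - a) + a * (1 - b) := by ring
       rw [this]
       refine (IsUltrametricDist.norm_add_le_max _ _).trans (max_le ha ?_)
       rw [norm_mul, hna, one_mul]
       exact hb
     inv_mem' := fun {a} ha => by
       simp only [Set.mem_setOf_eq, Units.val_inv_eq_inv_val] at ha ⊢
       have hna : ‖(a : F)‖ = 1 := norm_eq_one_of_norm_one_sub_lt (ha.trans_lt h1)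
       have ha0 : (a : F) ≠ 0 := norm_pos_iff.mp (by rw [hna]; exact one_pos)
       have : (1 : F) - (a : F)⁻¹ = -((a : F)⁻¹ * (1 - a)) := by field_simp; ring
       rw [this, norm_neg, norm_mul, norm_inv, hna, inv_one, one_mul]
       exact ha }, fun _ => Iff.rfl⟩

omit instF [IsUltrametricDist F] in
/-- `{u ∈ Fˣ : ‖1 - u‖ < 1}` is open in the unit group. [folklore] -/
theorem isOpen_setOf_norm_one_sub_lt : IsOpen {u : Fˣ | ‖1 - (u : F)‖ < 1} := by
  have : {u : Fˣ | ‖1 - (u : F)‖ < 1} = Units.val ⁻¹' Metric.ball (1 : F) 1 := by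
    ext u
    simp only [Set.mem_setOf_eq, Set.mem_preimage, Metric.mem_ball, dist_eq_norm, norm_sub_rev]
  rw [this]
  exact Units.continuous_val.isOpen_preimage _ Metric.isOpen_ball

omit instF in
/-- `{u ∈ Fˣ : ‖1 - u‖ ≤ ρ}` is open in the unit group for `ρ ≠ 0` (ultrametric: closed balls are
open). [folklore] -/
theorem isOpen_setOf_norm_one_sub_le {ρ : ℝ} (hρ : ρ ≠ 0) : IsOpen {u : Fˣ | ‖1 - (u : F)‖ ≤ ρ} := by
  have : {u : Fˣ | ‖1 - (u : F)‖ ≤ ρ} = Units.val ⁻¹' Metric.closedBall (1 : F) ρ := by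
    ext u
    simp only [Set.mem_setOf_eq, Set.mem_preimage, Metric.mem_closedBall, dist_eq_norm, norm_sub_rev]
  rw [this]
  exact Units.continuous_val.isOpen_preimage _ (IsUltrametricDist.isOpen_closedBall (1 : F) hρ)

/-! ### §2. Torsion in the principal units -/

omit instF in
/-- A finite ultrametric sum of terms of norm `< 1` has norm `< 1`. [folklore] -/
theorem norm_sum_lt_one {ι : Type*} (s : Finset ι) (f : ι → F) (h : ∀ i ∈ s, ‖f i‖ < 1) :
    ‖∑ i ∈ s, f i‖ < 1 := by
  classical
  induction s using Finset.induction_on with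
  | empty => simp
  | insert a s ha ih =>
    rw [Finset.sum_insert ha]
    exact (IsUltrametricDist.norm_add_le_max _ _).trans_lt
      (max_lt (h a (Finset.mem_insert_self a s)) (ih fun i hi => h i (Finset.mem_insert_of_mem hi)))

/-- **Norm of the cyclotomic factor at a principal unit**: for `‖1 - u‖ < 1` and `p ∤ m`,
`‖1 + u + ⋯ + u^{m-1}‖ = 1` (it is `≡ m (mod 𝔪)` and `‖m‖ = 1`).
[cite: Serre1973, Ch. II §3.1] -/
theorem norm_geom_sum_eq_one {u : F} (hu : ‖1 - u‖ < 1) {m : ℕ} (hm : p.Coprime m) :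
    ‖∑ i ∈ Finset.range m, u ^ i‖ = 1 := by
  have hm1 : ‖(m : F)‖ = 1 := by
    rw [IwasawaLog.norm_natCast p m]
    exact Padic.norm_natCast_eq_one_iff.mpr hm
  have hdiff : ‖∑ i ∈ Finset.range m, u ^ i - (m : F)‖ < 1 := by
    have hs : ∑ i ∈ Finset.range m, u ^ i - (m : F) = ∑ i ∈ Finset.range m, (u ^ i - 1) := by
      rw [Finset.sum_sub_distrib, Finset.sum_const, Finset.card_range, nsmul_eq_mul, mul_one]
    rw [hs]
    refine norm_sum_lt_one _ _ fun i _ => ?_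
    rw [← norm_neg, neg_sub]
    exact norm_one_sub_pow_lt hu i
  rw [← hm1]
  exact norm_eq_of_norm_sub_lt (by rw [hm1]; exact hdiff)

/-- **Principal units have no prime-to-`p` torsion**: `‖1 - u‖ < 1`, `u^m = 1`, `p ∤ m` `⟹ u = 1`
(`u^m - 1 = (u - 1)(1 + u + ⋯ + u^{m-1})` and the second factor is a unit).
[cite: Serre1973, Ch. II §3.1] -/
theorem eq_one_of_pow_eq_one_of_coprime {u : F} (hu : ‖1 - u‖ < 1) {m : ℕ} (hm : p.Coprime m)
    (hum : u ^ m = 1) : u = 1 := by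
  have hS : (∑ i ∈ Finset.range m, u ^ i) ≠ 0 :=
    norm_pos_iff.mp (by rw [norm_geom_sum_eq_one hu hm]; exact one_pos)
  have h : (∑ i ∈ Finset.range m, u ^ i) * (u - 1) = 0 := by rw [geom_sum_mul, hum, sub_self]
  rcases mul_eq_zero.mp h with h | h
  · exact absurd h hS
  · exact sub_eq_zero.mp h

/-- **No element of order two among the principal units, `p` odd**: `‖1 - u‖ < 1`, `u * u = 1`
`⟹ u = 1`. This is the only place where `p ≠ 2` enters LEMMA Λ′ ⇒ `FactorsThroughZp`.
[cite: Serre1973, Ch. II §3.1] -/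
theorem eq_one_of_mul_self_eq_one (hp : p ≠ 2) {u : F} (hu : ‖1 - u‖ < 1) (h2 : u * u = 1) :
    u = 1 := by
  have hcop : p.Coprime 2 := (Nat.coprime_primes (Fact.out) Nat.prime_two).mpr hp
  exact eq_one_of_pow_eq_one_of_coprime hu hcop (by rw [pow_two, h2])

/-- **At `p = 3`: a unit whose cube is principal is principal.** If `‖x‖ = 1` and
`‖1 - x³‖ < 1` then `‖1 - x‖ < 1`: otherwise `‖1 - x‖ = 1`, and `x² + x + 1 = (x - 1)² + 3x` has norm
`1` (`‖3x‖ < 1`), so `‖1 - x³‖ = ‖1 - x‖ · ‖x² + x + 1‖ = 1`. (The general-`p` statement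
"`x^p` principal ⟹ `x` principal" holds by `1 + x + ⋯ + x^{p-1} ≡ (x-1)^{p-1} (mod p)`; only
`p = 3` is needed here.) -- TODO(general form): every prime `p`.
[cite: Serre1973, Ch. II §3.1] -/
theorem norm_one_sub_lt_of_pow_three [Fact (Nat.Prime 3)] {F : Type*} [NormedField F]
    [NormedAlgebra ℚ_[3] F] [IsUltrametricDist F] {x : F} (hx : ‖x‖ = 1) (h3 : ‖1 - x ^ 3‖ < 1) :
    ‖1 - x‖ < 1 := by
  by_contra hge
  have hle : ‖1 - x‖ ≤ 1 := by
    have h := IsUltrametricDist.norm_add_le_max (1 : F) (-x)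
    rwa [← sub_eq_add_neg, norm_neg, norm_one, hx, max_self] at h
  have heq : ‖1 - x‖ = 1 := le_antisymm hle (not_lt.mp hge)
  -- `‖x² + x + 1‖ = 1`
  have h3lt : ‖(3 : F) * x‖ < 1 := by
    rw [norm_mul, hx, mul_one, show (3 : F) = ((3 : ℕ) : F) by norm_cast]
    exact IwasawaLog.norm_prime_lt_one (p := 3) (F := F)
  have hS : ‖x ^ 2 + x + 1‖ = 1 := by
    have hid : x ^ 2 + x + 1 - (1 - x) ^ 2 = 3 * x := by ring
    have hsq : ‖(1 - x) ^ 2‖ = 1 := by rw [norm_pow, heq, one_pow]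
    rw [← hsq]
    exact norm_eq_of_norm_sub_lt (by rw [hid, hsq]; exact h3lt)
  have hfac : (1 : F) - x ^ 3 = (1 - x) * (x ^ 2 + x + 1) := by ring
  rw [hfac, norm_mul, heq, hS, one_mul] at h3
  exact lt_irrefl _ h3

/-! ### §3. Continuous homomorphisms from a compact group into `Fˣ` -/

section Compact

variable {G : Type*} [Group G] [TopologicalSpace G] [CompactSpace G]

omit instF [IsUltrametricDist F] in
/-- **A continuous homomorphism from a compact group to `Fˣ` is unit-valued**: `‖g σ‖ = 1`
(the norms `‖g(σ^n)‖ = ‖g σ‖^{±n}` are bounded). [folklore] -/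
theorem norm_apply_eq_one (g : G →* Fˣ) (hg : Continuous g) (σ : G) : ‖((g σ : Fˣ) : F)‖ = 1 := by
  -- the continuous function `‖g ·‖` is bounded on the compact `G`
  have hcont : Continuous fun τ : G => ‖((g τ : Fˣ) : F)‖ :=
    continuous_norm.comp (Units.continuous_val.comp hg)
  obtain ⟨C, hC⟩ := (isCompact_univ.image hcont).isBounded.exists_norm_le
  have hC' : ∀ τ : G, ‖((g τ : Fˣ) : F)‖ ≤ C := fun τ => by
    have := hC _ ⟨τ, Set.mem_univ _, rfl⟩
    rwa [Real.norm_of_nonneg (norm_nonneg _)] at this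
  have hpow : ∀ (τ : G) (n : ℕ), ‖((g τ : Fˣ) : F)‖ ^ n ≤ C := fun τ n => by
    rw [← norm_pow, ← Units.val_pow_eq_pow_val, ← map_pow]
    exact hC' _
  -- neither `> 1` nor `< 1` is possible
  rcases lt_trichotomy ‖((g σ : Fˣ) : F)‖ 1 with h | h | h
  · exfalso
    have hpos : 0 < ‖((g σ : Fˣ) : F)‖ := norm_pos_iff.mpr (g σ).ne_zero
    have hinv : 1 < ‖((g σ⁻¹ : Fˣ) : F)‖ := by
      rw [map_inv, Units.val_inv_eq_inv_val, norm_inv]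
      exact one_lt_inv_iff₀.mpr ⟨hpos, h⟩
    obtain ⟨n, hn⟩ := pow_unbounded_of_one_lt C hinv
    exact absurd (hpow σ⁻¹ n) (not_le.mpr hn)
  · exact h
  · exfalso
    obtain ⟨n, hn⟩ := pow_unbounded_of_one_lt C h
    exact absurd (hpow σ n) (not_le.mpr hn)

omit instF [IsUltrametricDist F] in
/-- **Open subgroups swallow a power**: for a continuous homomorphism `g : G → Fˣ` from a compact
group and an open subgroup `B ≤ Fˣ`, some `n ≥ 1` has `g(σ)^n ∈ B` for all `σ` (`g⁻¹(B)` is an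
open, hence finite-index, normal subgroup of `G`). [folklore] -/
theorem exists_pow_mem_of_isOpen [IsTopologicalGroup G] (g : G →* Fˣ) (hg : Continuous g)
    (B : Subgroup Fˣ) (hB : IsOpen (B : Set Fˣ)) :
    ∃ n : ℕ, 0 < n ∧ ∀ σ : G, (g σ) ^ n ∈ B := by
  set H : Subgroup G := B.comap g with hH
  haveI : H.Normal := Subgroup.Normal.comap inferInstance g
  have hopen : IsOpen (H : Set G) := hB.preimage hg
  haveI : Finite (G ⧸ H) := Subgroup.quotient_finite_of_isOpen H hopen
  haveI : H.FiniteIndex := Subgroup.finiteIndex_of_finite_quotient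
  refine ⟨H.index, Nat.pos_of_ne_zero Subgroup.FiniteIndex.index_ne_zero, fun σ => ?_⟩
  have h := H.pow_index_mem σ
  rw [hH, Subgroup.mem_comap, map_pow] at h
  exact h

/-- **Stripping the `3`-part (`p = 3`)**: for a continuous homomorphism `g : G → Fˣ` from a compact
group there is `T ≥ 1` PRIME TO `3` with every `g(σ)^T` a principal unit (`g(σ)^{3^a T}` principal
for the index `3^a T` of the preimage of `P`, then `norm_one_sub_lt_of_pow_three` `a` times).
[cite: Serre1973, Ch. II §3.1] -/
theorem exists_pow_mem_principalUnits_coprime_three [Fact (Nat.Prime 3)] {F : Type*} [NormedField F]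
    [NormedAlgebra ℚ_[3] F] [IsUltrametricDist F] [IsTopologicalGroup G] (g : G →* Fˣ)
    (hg : Continuous g) (P : Subgroup Fˣ) (hP : ∀ u : Fˣ, u ∈ P ↔ ‖1 - (u : F)‖ < 1) :
    ∃ T : ℕ, 0 < T ∧ Nat.Coprime 3 T ∧ ∀ σ : G, (g σ) ^ T ∈ P := by
  have hPopen : IsOpen (P : Set Fˣ) := by
    have : (P : Set Fˣ) = {u : Fˣ | ‖1 - (u : F)‖ < 1} := Set.ext fun u => hP u
    rw [this]
    exact isOpen_setOf_norm_one_sub_lt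
  obtain ⟨n, hn, hmem⟩ := exists_pow_mem_of_isOpen g hg P hPopen
  -- `n = 3^a T` with `3 ∤ T`
  obtain ⟨a, T, hT3, rfl⟩ := Nat.exists_eq_pow_mul_and_not_dvd hn.ne' 3 (by norm_num)
  have hT : 0 < T := Nat.pos_of_ne_zero fun h => by simp [h] at hn
  refine ⟨T, hT, (Nat.Prime.coprime_iff_not_dvd Nat.prime_three).mpr hT3, fun σ => ?_⟩
  -- peel off the powers of `3`
  have key : ∀ (b : ℕ) (x : Fˣ), ‖(x : F)‖ = 1 → x ^ 3 ^ b ∈ P → x ∈ P := by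
    intro b
    induction b with
    | zero => intro x _ h; simpa using h
    | succ b ih =>
      intro x hx h
      rw [pow_succ', pow_mul] at h
      have h' := ih (x ^ 3) (by rw [Units.val_pow_eq_pow_val, norm_pow, hx, one_pow]) h
      rw [hP] at h' ⊢
      rw [Units.val_pow_eq_pow_val] at h'
      exact norm_one_sub_lt_of_pow_three hx h'
  refine key a ((g σ) ^ T) ?_ ?_
  · rw [Units.val_pow_eq_pow_val, norm_pow, norm_apply_eq_one g hg σ, one_pow]
  · rw [← pow_mul, mul_comm]; exact hmem σ

end Compact

end Summit.BirchSwinnertonDyer.Rank1Residual.X11b.Three.LambdaSupply.PadicUnits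

end
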